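import Summits.HodgeConjecture.CorCM.Model.Universe
import Summits.HodgeConjecture.CorCM.Model.KunnethTopClass
import HarnessLib

/-!
# COR-CM model layer, towards fact F7 `Fact_gysin` (row Fg7): top classes of the left-nested products
# `prodFin n X` and of their block decompositions

Cell `pub-hodgecm2` (COR-CM), seat `b25` (row Fg7), parts (d)+(f) of `FG7-GYSIN-PLAN.md` (seat `model-1`): for the
model universe `U₀ = Model.universeOf hHD hI hU h₃` (written out in full below) and a family `X : Fin (n+1) → Var`,

* `dim_prodFin_blocks` — `dim (∏_{k ≤ n+1+m} X_k) = dim (∏_{j ≤ n} X_{castAdd j}) + dim (∏_{i ≤ m} X_{natAdd i})`;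
* `exists_topClass_prodFin` — there is a NON-ZERO top class `c ∈ H^{2 dim}(∏ X_k; ℚ)` which is «determined by the
  factor projections»: two morphisms `g, g' : Q ⟶ ∏ X_k` whose pull-backs agree behind every `prj_k^*` agree on `c`
  (induction along `prodFin`, the binary Künneth top class `cup_pull_fst_pull_snd_top_ne_zero` at each step);
* `exists_stdBlockPair` — the genuine block projections `π_A`, `π_B` of `∏_{k ≤ n+1+m} X_k` onto the two partial
  products satisfy the pull-back compatibilities of the package's `IsBlockPair` AND `π_A^* c_Y ∪ π_B^* c_{Y'} ≠ 0`
  for all non-zero top classes `c_Y`, `c_{Y'}`;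
* `blockPair_top_ne_zero` — hence for ANY pair `p_A`, `p_B` with the `IsBlockPair` compatibilities (which pin
  `p_A^*`, `p_B^*` down only behind the factor projections) there are top classes with `p_A^* e ∪ p_B^* ω ≠ 0`:
  the hypothesis `hne` of `Model.exists_blockGysin` (`CorCM/Model/BlockGysin`).

All cup products are the degree-flexible `bettiCup (h : a + b = c)`, so no degree transport appears; the inductive
steps are index-free lemmas about a binary product `P₁ ⊗ L` (`topClass_step`, `blockTop_step`).

The factor projections enter only through a parameter `pr n X j : ∏_{k ≤ n} X_k ⟶ X_j` subject to the three
pull-back equations `pr_0^* = id`, `pr_{last}^* = snd^*`, `pr_{castSucc i}^* = fst^* ∘ pr_i^*` (hypotheses `hpr0`,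
`hprL`, `hprC`); the package's `Universe.prj` (`HodgeCM/Geometry/WeightVectors.lean`, port pending) satisfies them
(`simp [Universe.prj]`), which is how the junction file for `Fact_gysin` instantiates this one.
-/

noncomputable section

open CategoryTheory MonoidalCategory CartesianMonoidalCategory
open Literature.AlgebraicTopology.SingularHomology
open Literature.AlgebraicGeometry.Motives (SchemeOver ComplexPoints IsSmoothProjective bettiCohomology bettiCup
  bettiCup_map bettiCup_assoc)
open Literature.AlgebraicGeometry.HodgeTheory
open Literature.NumberTheory.Automorphic.PicardCM

namespace Summit.HodgeConjecture.CorCM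


namespace Model

/-! ### Index-free lemmas about a binary product `P₁ ⊗ L` -/

section General

variable {S P Q Y T L P₁ Y'₁ : SchemeOver ℂ}

/-- Pull-back is multiplicative for the degree-flexible cup product `bettiCup h`. -/
theorem pull_bettiCup (f : S ⟶ P) {p q r : ℕ} (h : p + q = r) (a : bettiCohomology P p)
    (b : bettiCohomology P q) :
    BettiUniverse.pull f r (bettiCup h a b) = bettiCup h (BettiUniverse.pull f p a) (BettiUniverse.pull f q b) :=
  bettiCup_map f h a b

/-- `(f ≫ π)^* ∘ q^* = (f ≫ r)^*` from `π^* ∘ q^* = r^*`. -/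
theorem pull_comp_comp_eq (f : S ⟶ P) (π : P ⟶ Y) (q : Y ⟶ T) (r : P ⟶ T) (k : ℕ)
    (h : BettiUniverse.pull π k ∘ₗ BettiUniverse.pull q k = BettiUniverse.pull r k) :
    BettiUniverse.pull (f ≫ π) k ∘ₗ BettiUniverse.pull q k = BettiUniverse.pull (f ≫ r) k := by
  rw [BettiUniverse.pull_comp, BettiUniverse.pull_comp, LinearMap.comp_assoc, h]

/-- **Top-class step.**  For a non-zero top class `c'` of `P'` there is a non-zero class `c` of `P' ⊗ L` in
degree `2 dim P' + 2 dim L` on which two morphisms `g, g' : Q ⟶ P' ⊗ L` agree as soon as `(g ≫ fst)^* c' =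
(g' ≫ fst)^* c'` and `g^* ∘ snd^* = g'^* ∘ snd^*`; namely `c = fst^* c' ∪ snd^* a` for a top generator `a` of `L`. -/
theorem topClass_step {dP' dL : ℕ} {P' : SchemeOver ℂ} (hP' : IsSmoothProjective dP' P')
    (hL : IsSmoothProjective dL L) {c' : bettiCohomology P' (2 * dP')} (hc' : c' ≠ 0) {t : ℕ}
    (ht : 2 * dP' + 2 * dL = t) :
    ∃ c : bettiCohomology (P' ⊗ L) t, c ≠ 0 ∧ ∀ (Q : SchemeOver ℂ) (g g' : Q ⟶ P' ⊗ L),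
      BettiUniverse.pull (g ≫ fst P' L) _ c' = BettiUniverse.pull (g' ≫ fst P' L) _ c' →
      BettiUniverse.pull g (2 * dL) ∘ₗ BettiUniverse.pull (snd P' L) (2 * dL) =
        BettiUniverse.pull g' (2 * dL) ∘ₗ BettiUniverse.pull (snd P' L) (2 * dL) →
      BettiUniverse.pull g t c = BettiUniverse.pull g' t c := by
  subst ht
  have h1 : Module.finrank ℚ (bettiCohomology L (2 * dL)) = 1 := finrank_rat_top hL
  set a := BettiUniverse.lineBasis hL _ h1 0 with ha
  have ha0 : a ≠ 0 := (BettiUniverse.lineBasis hL _ h1).ne_zero 0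
  refine ⟨BettiUniverse.cup (P' ⊗ L) _ _ (BettiUniverse.pull (fst P' L) _ c') (BettiUniverse.pull (snd P' L) _ a),
    cup_pull_fst_pull_snd_top_ne_zero hP' hL hc' ha0, fun Q g g' hfst hsnd ↦ ?_⟩
  rw [BettiUniverse.pull_cup, BettiUniverse.pull_cup, ← LinearMap.comp_apply (f := BettiUniverse.pull g (2 * dP')),
    ← BettiUniverse.pull_comp, hfst, BettiUniverse.pull_comp, LinearMap.comp_apply,
    ← LinearMap.comp_apply (f := BettiUniverse.pull g (2 * dL)), hsnd, LinearMap.comp_apply]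

/-- **Block step.**  If `π_A₁ : P₁ ⟶ Y`, `π_B₁ : P₁ ⟶ Y'₁` send every pair of non-zero top classes to a non-zero
top cup product on `P₁`, then so do `fst ≫ π_A₁ : P₁ ⊗ L ⟶ Y` and `lift (fst ≫ π_B₁) snd : P₁ ⊗ L ⟶ Y'₁ ⊗ L`
(binary Künneth top class on `Y'₁ ⊗ L` and on `P₁ ⊗ L`, associativity of the cup product). -/
theorem blockTop_step {dP₁ dL dY dY'₁ : ℕ} (hP₁ : IsSmoothProjective dP₁ P₁) (hL : IsSmoothProjective dL L)
    (hY'₁ : IsSmoothProjective dY'₁ Y'₁) (πA₁ : P₁ ⟶ Y) (πB₁ : P₁ ⟶ Y'₁) (hd : 2 * dY + 2 * dY'₁ = 2 * dP₁)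
    (hT₁ : ∀ (cY : bettiCohomology Y (2 * dY)) (c₁ : bettiCohomology Y'₁ (2 * dY'₁)), cY ≠ 0 → c₁ ≠ 0 →
      bettiCup hd (BettiUniverse.pull πA₁ _ cY) (BettiUniverse.pull πB₁ _ c₁) ≠ 0)
    {t tY' : ℕ} (htY' : 2 * dY'₁ + 2 * dL = tY') (ht : 2 * dY + tY' = t)
    (cY : bettiCohomology Y (2 * dY)) (cY' : bettiCohomology (Y'₁ ⊗ L) tY') (hcY : cY ≠ 0) (hcY' : cY' ≠ 0) :
    bettiCup ht (BettiUniverse.pull (fst P₁ L ≫ πA₁) _ cY)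
      (BettiUniverse.pull (lift (fst P₁ L ≫ πB₁) (snd P₁ L)) _ cY') ≠ 0 := by
  subst htY'
  -- `cY' = λ • (fst^* c₁ ∪ snd^* a)` on `Y'₁ ⊗ L`
  have h1Y'₁ : Module.finrank ℚ (bettiCohomology Y'₁ (2 * dY'₁)) = 1 := finrank_rat_top hY'₁
  have h1L : Module.finrank ℚ (bettiCohomology L (2 * dL)) = 1 := finrank_rat_top hL
  set c₁ := BettiUniverse.lineBasis hY'₁ _ h1Y'₁ 0 with hc₁
  have hc₁0 : c₁ ≠ 0 := (BettiUniverse.lineBasis hY'₁ _ h1Y'₁).ne_zero 0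
  set a := BettiUniverse.lineBasis hL _ h1L 0 with ha
  have ha0 : a ≠ 0 := (BettiUniverse.lineBasis hL _ h1L).ne_zero 0
  set K := BettiUniverse.cup (Y'₁ ⊗ L) _ _ (BettiUniverse.pull (fst Y'₁ L) _ c₁) (BettiUniverse.pull (snd Y'₁ L) _ a)
    with hK
  have hK0 : K ≠ 0 := cup_pull_fst_pull_snd_top_ne_zero hY'₁ hL hc₁0 ha0
  have h1Y' : Module.finrank ℚ (bettiCohomology (Y'₁ ⊗ L) (2 * dY'₁ + 2 * dL)) = 1 := by
    rw [two_mul_add_two_mul]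
    exact finrank_rat_top (Literature.AlgebraicGeometry.Motives.IsSmoothProjective.tensor_holds hY'₁ hL)
  obtain ⟨lam, rfl⟩ := exists_smul_eq_of_finrank_eq_one h1Y' hK0 cY'
  have hlam : lam ≠ 0 := by rintro rfl; exact hcY' (zero_smul _ _)
  -- the non-zero top class `w = π_A₁^* cY ∪ π_B₁^* c₁` of `P₁`
  have hw : bettiCup hd (BettiUniverse.pull πA₁ _ cY) (BettiUniverse.pull πB₁ _ c₁) ≠ 0 := hT₁ cY c₁ hcY hc₁0
  have hm : 2 * dP₁ + 2 * dL = t := by omega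
  -- compute
  have hπBK : BettiUniverse.pull (lift (fst P₁ L ≫ πB₁) (snd P₁ L)) _ K =
      BettiUniverse.cup (P₁ ⊗ L) _ _ (BettiUniverse.pull (fst P₁ L) _ (BettiUniverse.pull πB₁ _ c₁))
        (BettiUniverse.pull (snd P₁ L) _ a) := by
    rw [hK, BettiUniverse.pull_cup, ← LinearMap.comp_apply (g := BettiUniverse.pull (fst Y'₁ L) _),
      ← BettiUniverse.pull_comp, lift_fst, BettiUniverse.pull_comp, LinearMap.comp_apply,
      ← LinearMap.comp_apply (g := BettiUniverse.pull (snd Y'₁ L) _) (f := BettiUniverse.pull (lift _ _) _),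
      ← BettiUniverse.pull_comp, lift_snd]
  rw [LinearMap.map_smul, LinearMap.map_smul, hπBK, BettiUniverse.pull_comp, LinearMap.comp_apply]
  change lam • bettiCup ht _ (bettiCup rfl _ _) ≠ 0
  rw [← bettiCup_assoc hd rfl hm ht, ← pull_bettiCup]
  refine smul_ne_zero hlam fun h0 ↦ cup_pull_fst_pull_snd_top_ne_zero hP₁ hL hw ha0 ?_
  exact (cupProduct_eq_zero_iff_of_eq hm rfl _ _).1 h0

end General

/-! ### The left-nested products of the model universe -/

section ProdFin

/-- **Additivity of the dimension over the two blocks** of a concatenated product: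
`dim (∏_{k ≤ n+1+m} X_k) = dim (∏_{j ≤ n} X_{castAdd j}) + dim (∏_{i ≤ m} X_{natAdd i})`. -/
theorem dim_prodFin_blocks (hHD : exists_isReal_hodgeModel) (hI : hodgePQ_independent_of_hodgeModel)
    (hU : BallQuotientUniformisedDatum) (h₃ : CMAbelianVarietyRealised) (n : ℕ) :
    ∀ (m : ℕ) (X : Fin (n + 1 + (m + 1)) → Var),
      Var.dim ((universeOf hHD hI hU h₃).prodFin (n + 1 + m) X) =
        Var.dim ((universeOf hHD hI hU h₃).prodFin n fun j => X (Fin.castAdd (m + 1) j)) +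
          Var.dim ((universeOf hHD hI hU h₃).prodFin m fun i => X (Fin.natAdd (n + 1) i)) := by
  intro m
  induction m with
  | zero => intro X; rfl
  | succ m ih =>
    intro X
    have h := ih (fun i => X i.castSucc)
    exact (congrArg (· + Var.dim (X (Fin.last (n + 1 + m + 1)))) h).trans (Nat.add_assoc _ _ _)

/-- **A non-zero top class of `∏_{k ≤ n} X_k` determined by the factor projections**: there is
`c ∈ H^{2 dim}(∏ X_k; ℚ)`, `c ≠ 0`, such that any two morphisms `g, g' : Q ⟶ ∏ X_k` with
`g^* ∘ pr_k^* = g'^* ∘ pr_k^*` for all `k` (all degrees) satisfy `g^* c = g'^* c`. -/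
theorem exists_topClass_prodFin (hHD : exists_isReal_hodgeModel) (hI : hodgePQ_independent_of_hodgeModel)
    (hU : BallQuotientUniformisedDatum) (h₃ : CMAbelianVarietyRealised)
    (pr : (n : ℕ) → (X : Fin (n + 1) → Var) → (j : Fin (n + 1)) → Var.Mor hU h₃ ((universeOf hHD hI hU h₃).prodFin n X) (X j))
    (hpr0 : ∀ (X : Fin (0 + 1) → Var) (k : ℕ), BettiUniverse.pull (pr 0 X 0) k = LinearMap.id)
    (hprL : ∀ (n : ℕ) (X : Fin (n + 1 + 1) → Var) (k : ℕ),
      BettiUniverse.pull (pr (n + 1) X (Fin.last (n + 1))) k =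
        BettiUniverse.pull (X := Var.scheme hU h₃ ((universeOf hHD hI hU h₃).prodFin (n + 1) X)) (Y := Var.scheme hU h₃ (X (Fin.last (n + 1))))
          (snd (Var.scheme hU h₃ ((universeOf hHD hI hU h₃).prodFin n fun i => X i.castSucc)) (Var.scheme hU h₃ (X (Fin.last (n + 1))))) k)
    (hprC : ∀ (n : ℕ) (X : Fin (n + 1 + 1) → Var) (i : Fin (n + 1)) (k : ℕ),
      BettiUniverse.pull (pr (n + 1) X i.castSucc) k =
        BettiUniverse.pull (X := Var.scheme hU h₃ ((universeOf hHD hI hU h₃).prodFin (n + 1) X))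
            (Y := Var.scheme hU h₃ ((universeOf hHD hI hU h₃).prodFin n fun i => X i.castSucc))
            (fst (Var.scheme hU h₃ ((universeOf hHD hI hU h₃).prodFin n fun i => X i.castSucc)) (Var.scheme hU h₃ (X (Fin.last (n + 1))))) k ∘ₗ
          BettiUniverse.pull (pr n (fun i => X i.castSucc) i) k)
    (n : ℕ) : ∀ (X : Fin (n + 1) → Var),
    ∃ c : Var.Coh hU h₃ ((universeOf hHD hI hU h₃).prodFin n X) (2 * Var.dim ((universeOf hHD hI hU h₃).prodFin n X)), c ≠ 0 ∧
      ∀ (Q : Var) (g g' : Var.Mor hU h₃ Q ((universeOf hHD hI hU h₃).prodFin n X)),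
        (∀ (k : Fin (n + 1)) (i : ℕ),
            BettiUniverse.pull g i ∘ₗ BettiUniverse.pull (pr n X k) i =
              BettiUniverse.pull g' i ∘ₗ BettiUniverse.pull (pr n X k) i) →
        BettiUniverse.pull g _ c = BettiUniverse.pull g' _ c := by
  induction n with
  | zero =>
    intro X
    have h1 : Module.finrank ℚ (Var.Coh hU h₃ (X 0) (2 * (X 0).dim)) = 1 :=
      finrank_rat_top (Var.isSmoothProjective hU h₃ (X 0))
    refine ⟨BettiUniverse.lineBasis (Var.isSmoothProjective hU h₃ (X 0)) _ h1 0,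
      (BettiUniverse.lineBasis (Var.isSmoothProjective hU h₃ (X 0)) _ h1).ne_zero 0, ?_⟩
    intro Q g g' hgg
    have h := LinearMap.congr_fun (hgg 0 (2 * (X 0).dim))
      (BettiUniverse.lineBasis (Var.isSmoothProjective hU h₃ (X 0)) _ h1 0)
    have e := LinearMap.congr_fun (hpr0 X (2 * (X 0).dim))
      (BettiUniverse.lineBasis (Var.isSmoothProjective hU h₃ (X 0)) _ h1 0)
    exact ((congrArg (BettiUniverse.pull g _) e).symm.trans h).trans (congrArg (BettiUniverse.pull g' _) e)
  | succ n ih =>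
    intro X
    obtain ⟨c', hc'0, hc'⟩ := ih (fun i => X i.castSucc)
    have hdeg : 2 * Var.dim ((universeOf hHD hI hU h₃).prodFin n fun i => X i.castSucc) + 2 * (X (Fin.last (n + 1))).dim =
        2 * Var.dim ((universeOf hHD hI hU h₃).prodFin (n + 1) X) := by
      show _ = 2 * (Var.dim ((universeOf hHD hI hU h₃).prodFin n fun i => X i.castSucc) + (X (Fin.last (n + 1))).dim)
      ring
    obtain ⟨c, hc0, hc⟩ := topClass_step (L := Var.scheme hU h₃ (X (Fin.last (n + 1))))
      (Var.isSmoothProjective hU h₃ ((universeOf hHD hI hU h₃).prodFin n fun i => X i.castSucc))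
      (Var.isSmoothProjective hU h₃ (X (Fin.last (n + 1)))) hc'0 hdeg
    refine ⟨c, hc0, fun Q g g' hgg ↦ hc (Var.scheme hU h₃ Q) g g' ?_ ?_⟩
    · refine hc' Q _ _ fun k i ↦ ?_
      have h := hgg k.castSucc i
      rw [hprC] at h
      simp only [← LinearMap.comp_assoc] at h
      rw [← BettiUniverse.pull_comp g, ← BettiUniverse.pull_comp g'] at h
      exact h
    · have h := hgg (Fin.last (n + 1)) (2 * (X (Fin.last (n + 1))).dim)
      rw [hprL] at h
      exact h

/-- **The genuine block projections** `π_A : ∏_{k ≤ n+1+m} X_k ⟶ ∏_{j ≤ n} X_{castAdd j}` and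
`π_B : ∏_{k ≤ n+1+m} X_k ⟶ ∏_{i ≤ m} X_{natAdd i}` (iterated first projection, resp. built with the universal
property of the binary product): they satisfy the pull-back compatibilities of the package's `IsBlockPair`, and
`π_A^* c_Y ∪ π_B^* c_{Y'} ≠ 0` for all non-zero top classes `c_Y`, `c_{Y'}` of the two partial products. -/
theorem exists_stdBlockPair (hHD : exists_isReal_hodgeModel) (hI : hodgePQ_independent_of_hodgeModel)
    (hU : BallQuotientUniformisedDatum) (h₃ : CMAbelianVarietyRealised)
    (pr : (n : ℕ) → (X : Fin (n + 1) → Var) → (j : Fin (n + 1)) → Var.Mor hU h₃ ((universeOf hHD hI hU h₃).prodFin n X) (X j))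
    (hpr0 : ∀ (X : Fin (0 + 1) → Var) (k : ℕ), BettiUniverse.pull (pr 0 X 0) k = LinearMap.id)
    (hprL : ∀ (n : ℕ) (X : Fin (n + 1 + 1) → Var) (k : ℕ),
      BettiUniverse.pull (pr (n + 1) X (Fin.last (n + 1))) k =
        BettiUniverse.pull (X := Var.scheme hU h₃ ((universeOf hHD hI hU h₃).prodFin (n + 1) X)) (Y := Var.scheme hU h₃ (X (Fin.last (n + 1))))
          (snd (Var.scheme hU h₃ ((universeOf hHD hI hU h₃).prodFin n fun i => X i.castSucc)) (Var.scheme hU h₃ (X (Fin.last (n + 1))))) k)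
    (hprC : ∀ (n : ℕ) (X : Fin (n + 1 + 1) → Var) (i : Fin (n + 1)) (k : ℕ),
      BettiUniverse.pull (pr (n + 1) X i.castSucc) k =
        BettiUniverse.pull (X := Var.scheme hU h₃ ((universeOf hHD hI hU h₃).prodFin (n + 1) X))
            (Y := Var.scheme hU h₃ ((universeOf hHD hI hU h₃).prodFin n fun i => X i.castSucc))
            (fst (Var.scheme hU h₃ ((universeOf hHD hI hU h₃).prodFin n fun i => X i.castSucc)) (Var.scheme hU h₃ (X (Fin.last (n + 1))))) k ∘ₗ
          BettiUniverse.pull (pr n (fun i => X i.castSucc) i) k)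
    (n : ℕ) : ∀ (m : ℕ) (X : Fin (n + 1 + (m + 1)) → Var),
    ∃ (πA : Var.Mor hU h₃ ((universeOf hHD hI hU h₃).prodFin (n + 1 + m) X) ((universeOf hHD hI hU h₃).prodFin n fun j => X (Fin.castAdd (m + 1) j)))
      (πB : Var.Mor hU h₃ ((universeOf hHD hI hU h₃).prodFin (n + 1 + m) X) ((universeOf hHD hI hU h₃).prodFin m fun i => X (Fin.natAdd (n + 1) i))),
      (∀ (j : Fin (n + 1)) (k : ℕ),
          BettiUniverse.pull πA k ∘ₗ BettiUniverse.pull (pr n (fun j => X (Fin.castAdd (m + 1) j)) j) k =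
            BettiUniverse.pull (pr (n + 1 + m) X (Fin.castAdd (m + 1) j)) k) ∧
      (∀ (i : Fin (m + 1)) (k : ℕ),
          BettiUniverse.pull πB k ∘ₗ BettiUniverse.pull (pr m (fun i => X (Fin.natAdd (n + 1) i)) i) k =
            BettiUniverse.pull (pr (n + 1 + m) X (Fin.natAdd (n + 1) i)) k) ∧
      ∀ (t : ℕ) (ht : 2 * Var.dim ((universeOf hHD hI hU h₃).prodFin n fun j => X (Fin.castAdd (m + 1) j)) +
            2 * Var.dim ((universeOf hHD hI hU h₃).prodFin m fun i => X (Fin.natAdd (n + 1) i)) = t)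
        (cY : Var.Coh hU h₃ ((universeOf hHD hI hU h₃).prodFin n fun j => X (Fin.castAdd (m + 1) j))
          (2 * Var.dim ((universeOf hHD hI hU h₃).prodFin n fun j => X (Fin.castAdd (m + 1) j))))
        (cY' : Var.Coh hU h₃ ((universeOf hHD hI hU h₃).prodFin m fun i => X (Fin.natAdd (n + 1) i))
          (2 * Var.dim ((universeOf hHD hI hU h₃).prodFin m fun i => X (Fin.natAdd (n + 1) i)))),
        cY ≠ 0 → cY' ≠ 0 → bettiCup ht (BettiUniverse.pull πA _ cY) (BettiUniverse.pull πB _ cY') ≠ 0 := by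
  intro m
  induction m with
  | zero =>
    intro X
    -- `P = Y × X_last`, `Y' = X_last`: `π_A = fst`, `π_B = snd`
    refine ⟨(fst (Var.scheme hU h₃ ((universeOf hHD hI hU h₃).prodFin n fun i => X i.castSucc)) (Var.scheme hU h₃ (X (Fin.last (n + 1)))) :
        Var.Mor hU h₃ ((universeOf hHD hI hU h₃).prodFin (n + 1) X) ((universeOf hHD hI hU h₃).prodFin n fun i => X i.castSucc)),
      (snd (Var.scheme hU h₃ ((universeOf hHD hI hU h₃).prodFin n fun i => X i.castSucc)) (Var.scheme hU h₃ (X (Fin.last (n + 1)))) :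
        Var.Mor hU h₃ ((universeOf hHD hI hU h₃).prodFin (n + 1) X) (X (Fin.last (n + 1)))),
      ?_, ?_, ?_⟩
    · intro j k
      exact (hprC n X j k).symm
    · intro i k
      obtain rfl : i = 0 := Fin.fin_one_eq_zero i
      refine LinearMap.ext fun x => ?_
      have e0 := LinearMap.congr_fun (hpr0 (fun i => X (Fin.natAdd (n + 1) i)) k) x
      have e := LinearMap.congr_fun (hprL n X k) x
      exact (congrArg (BettiUniverse.pull
        (X := Var.scheme hU h₃ ((universeOf hHD hI hU h₃).prodFin (n + 1) X)) (Y := Var.scheme hU h₃ (X (Fin.last (n + 1))))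
        (snd (Var.scheme hU h₃ ((universeOf hHD hI hU h₃).prodFin n fun i => X i.castSucc)) (Var.scheme hU h₃ (X (Fin.last (n + 1))))) k) e0).trans
        e.symm
    · intro t ht cY cY' hcY hcY' h0
      exact cup_pull_fst_pull_snd_top_ne_zero (Var.isSmoothProjective hU h₃ ((universeOf hHD hI hU h₃).prodFin n fun i => X i.castSucc))
        (Var.isSmoothProjective hU h₃ (X (Fin.last (n + 1))))
        hcY hcY' ((cupProduct_eq_zero_iff_of_eq ht rfl _ _).1 h0)
  | succ m ih =>
    intro X
    -- the shorter concatenated product `P₁ = ∏_{k ≤ n+1+m} X_{castSucc k}` with its block pair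
    obtain ⟨πA₁, πB₁, hA₁, hB₁, hT₁⟩ := ih (fun i => X i.castSucc)
    have hP₁ := Var.isSmoothProjective hU h₃ ((universeOf hHD hI hU h₃).prodFin (n + 1 + m) fun i : Fin (n + 1 + (m + 1)) => X i.castSucc)
    have hL := Var.isSmoothProjective hU h₃ (X (Fin.last (n + 1 + m + 1)))
    have hY'₁ := Var.isSmoothProjective hU h₃
      ((universeOf hHD hI hU h₃).prodFin m fun i => (fun i : Fin (n + 1 + (m + 1)) => X i.castSucc) (Fin.natAdd (n + 1) i))
    have hdP₁ : 2 * Var.dim ((universeOf hHD hI hU h₃).prodFin n fun j => (fun i : Fin (n + 1 + (m + 1)) => X i.castSucc) (Fin.castAdd (m + 1) j)) +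
        2 * Var.dim ((universeOf hHD hI hU h₃).prodFin m fun i => (fun i : Fin (n + 1 + (m + 1)) => X i.castSucc) (Fin.natAdd (n + 1) i)) =
        2 * Var.dim ((universeOf hHD hI hU h₃).prodFin (n + 1 + m) fun i : Fin (n + 1 + (m + 1)) => X i.castSucc) := by
      rw [dim_prodFin_blocks hHD hI hU h₃ n m (fun i => X i.castSucc)]
      ring
    refine ⟨(fst (Var.scheme hU h₃ ((universeOf hHD hI hU h₃).prodFin (n + 1 + m) fun i : Fin (n + 1 + (m + 1)) => X i.castSucc))
          (Var.scheme hU h₃ (X (Fin.last (n + 1 + m + 1)))) ≫ πA₁ :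
        Var.Mor hU h₃ ((universeOf hHD hI hU h₃).prodFin (n + 1 + (m + 1)) X) ((universeOf hHD hI hU h₃).prodFin n fun j => X (Fin.castAdd (m + 1 + 1) j))),
      (lift (fst (Var.scheme hU h₃ ((universeOf hHD hI hU h₃).prodFin (n + 1 + m) fun i : Fin (n + 1 + (m + 1)) => X i.castSucc))
          (Var.scheme hU h₃ (X (Fin.last (n + 1 + m + 1)))) ≫ πB₁)
        (snd (Var.scheme hU h₃ ((universeOf hHD hI hU h₃).prodFin (n + 1 + m) fun i : Fin (n + 1 + (m + 1)) => X i.castSucc))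
          (Var.scheme hU h₃ (X (Fin.last (n + 1 + m + 1))))) :
        Var.Mor hU h₃ ((universeOf hHD hI hU h₃).prodFin (n + 1 + (m + 1)) X) ((universeOf hHD hI hU h₃).prodFin (m + 1) fun i => X (Fin.natAdd (n + 1) i))),
      ?_, ?_, ?_⟩
    · -- compatibility of `π_A` with the first-block projections
      intro j k
      refine (pull_comp_comp_eq _ πA₁ _ _ k (hA₁ j k)).trans ?_
      refine Eq.trans ?_ (hprC (n + 1 + m) X (Fin.castAdd (m + 1) j) k).symm
      exact BettiUniverse.pull_comp _ _ k
    · -- compatibility of `π_B` with the second-block projections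
      intro i k
      induction i using Fin.lastCases with
      | last =>
        rw [hprL, ← BettiUniverse.pull_comp]
        refine Eq.trans ?_ (hprL (n + 1 + m) X k).symm
        exact congrArg (BettiUniverse.pull · k) (lift_snd _ _)
      | cast i =>
        rw [hprC, ← LinearMap.comp_assoc, ← BettiUniverse.pull_comp]
        refine Eq.trans ?_ (hprC (n + 1 + m) X (Fin.natAdd (n + 1) i) k).symm
        refine Eq.trans ?_ ((pull_comp_comp_eq _ πB₁ _ _ k (hB₁ i k)).trans (BettiUniverse.pull_comp _ _ k))
        exact congrArg (fun f => BettiUniverse.pull f k ∘ₗ _) (lift_fst _ _)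
    · -- the top classes
      intro t ht cY cY' hcY hcY'
      have htY' : 2 * Var.dim ((universeOf hHD hI hU h₃).prodFin m fun i => (fun i : Fin (n + 1 + (m + 1)) => X i.castSucc) (Fin.natAdd (n + 1) i)) +
          2 * (X (Fin.last (n + 1 + m + 1))).dim = 2 * Var.dim ((universeOf hHD hI hU h₃).prodFin (m + 1) fun i => X (Fin.natAdd (n + 1) i)) := by
        show _ = 2 * (Var.dim ((universeOf hHD hI hU h₃).prodFin m fun i => (fun i : Fin (n + 1 + (m + 1)) => X i.castSucc)
          (Fin.natAdd (n + 1) i)) + (X (Fin.last (n + 1 + m + 1))).dim)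
        ring
      have hfam : Var.dim ((universeOf hHD hI hU h₃).prodFin n fun j => (fun i : Fin (n + 1 + (m + 1)) => X i.castSucc) (Fin.castAdd (m + 1) j)) =
          Var.dim ((universeOf hHD hI hU h₃).prodFin n fun j => X (Fin.castAdd (m + 1 + 1) j)) := rfl
      have ht' : 2 * Var.dim ((universeOf hHD hI hU h₃).prodFin n fun j => (fun i : Fin (n + 1 + (m + 1)) => X i.castSucc) (Fin.castAdd (m + 1) j)) +
          2 * Var.dim ((universeOf hHD hI hU h₃).prodFin (m + 1) fun i => X (Fin.natAdd (n + 1) i)) = t := by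
        rw [hfam]; exact ht
      exact blockTop_step hP₁ hL hY'₁ πA₁ πB₁ hdP₁ (fun cY c₁ h h' ↦ hT₁ _ hdP₁ cY c₁ h h') htY' ht' cY cY' hcY hcY'

/-- **Any pair with the `IsBlockPair` compatibilities sees a non-zero top cup product**: if
`p_A^* ∘ pr_j^* = pr_{castAdd j}^*` and `p_B^* ∘ pr_i^* = pr_{natAdd i}^*` in all degrees, then
`p_A^* e ∪ p_B^* ω ≠ 0` for suitable top classes `e`, `ω` of the two partial products (the hypothesis `hne` of
`Model.exists_blockGysin`). -/
theorem blockPair_top_ne_zero (hHD : exists_isReal_hodgeModel) (hI : hodgePQ_independent_of_hodgeModel)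
    (hU : BallQuotientUniformisedDatum) (h₃ : CMAbelianVarietyRealised)
    (pr : (n : ℕ) → (X : Fin (n + 1) → Var) → (j : Fin (n + 1)) → Var.Mor hU h₃ ((universeOf hHD hI hU h₃).prodFin n X) (X j))
    (hpr0 : ∀ (X : Fin (0 + 1) → Var) (k : ℕ), BettiUniverse.pull (pr 0 X 0) k = LinearMap.id)
    (hprL : ∀ (n : ℕ) (X : Fin (n + 1 + 1) → Var) (k : ℕ),
      BettiUniverse.pull (pr (n + 1) X (Fin.last (n + 1))) k =
        BettiUniverse.pull (X := Var.scheme hU h₃ ((universeOf hHD hI hU h₃).prodFin (n + 1) X)) (Y := Var.scheme hU h₃ (X (Fin.last (n + 1))))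
          (snd (Var.scheme hU h₃ ((universeOf hHD hI hU h₃).prodFin n fun i => X i.castSucc)) (Var.scheme hU h₃ (X (Fin.last (n + 1))))) k)
    (hprC : ∀ (n : ℕ) (X : Fin (n + 1 + 1) → Var) (i : Fin (n + 1)) (k : ℕ),
      BettiUniverse.pull (pr (n + 1) X i.castSucc) k =
        BettiUniverse.pull (X := Var.scheme hU h₃ ((universeOf hHD hI hU h₃).prodFin (n + 1) X))
            (Y := Var.scheme hU h₃ ((universeOf hHD hI hU h₃).prodFin n fun i => X i.castSucc))
            (fst (Var.scheme hU h₃ ((universeOf hHD hI hU h₃).prodFin n fun i => X i.castSucc)) (Var.scheme hU h₃ (X (Fin.last (n + 1))))) k ∘ₗ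
          BettiUniverse.pull (pr n (fun i => X i.castSucc) i) k)
    (n m : ℕ) (X : Fin (n + 1 + (m + 1)) → Var)
    (pA : Var.Mor hU h₃ ((universeOf hHD hI hU h₃).prodFin (n + 1 + m) X) ((universeOf hHD hI hU h₃).prodFin n fun j => X (Fin.castAdd (m + 1) j)))
    (pB : Var.Mor hU h₃ ((universeOf hHD hI hU h₃).prodFin (n + 1 + m) X) ((universeOf hHD hI hU h₃).prodFin m fun i => X (Fin.natAdd (n + 1) i)))
    (hA : ∀ (j : Fin (n + 1)) (k : ℕ),
      BettiUniverse.pull pA k ∘ₗ BettiUniverse.pull (pr n (fun j => X (Fin.castAdd (m + 1) j)) j) k =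
        BettiUniverse.pull (pr (n + 1 + m) X (Fin.castAdd (m + 1) j)) k)
    (hB : ∀ (i : Fin (m + 1)) (k : ℕ),
      BettiUniverse.pull pB k ∘ₗ BettiUniverse.pull (pr m (fun i => X (Fin.natAdd (n + 1) i)) i) k =
        BettiUniverse.pull (pr (n + 1 + m) X (Fin.natAdd (n + 1) i)) k) :
    ∃ (t : ℕ) (ht : 2 * Var.dim ((universeOf hHD hI hU h₃).prodFin n fun j => X (Fin.castAdd (m + 1) j)) +
        2 * Var.dim ((universeOf hHD hI hU h₃).prodFin m fun i => X (Fin.natAdd (n + 1) i)) = t)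
      (e : Var.Coh hU h₃ ((universeOf hHD hI hU h₃).prodFin n fun j => X (Fin.castAdd (m + 1) j))
        (2 * Var.dim ((universeOf hHD hI hU h₃).prodFin n fun j => X (Fin.castAdd (m + 1) j))))
      (ω : Var.Coh hU h₃ ((universeOf hHD hI hU h₃).prodFin m fun i => X (Fin.natAdd (n + 1) i))
        (2 * Var.dim ((universeOf hHD hI hU h₃).prodFin m fun i => X (Fin.natAdd (n + 1) i)))),
      bettiCup ht (BettiUniverse.pull pA _ e) (BettiUniverse.pull pB _ ω) ≠ 0 := by
  obtain ⟨cY, hcY0, hcY⟩ :=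
    exists_topClass_prodFin hHD hI hU h₃ pr hpr0 hprL hprC n (fun j => X (Fin.castAdd (m + 1) j))
  obtain ⟨cY', hcY'0, hcY'⟩ :=
    exists_topClass_prodFin hHD hI hU h₃ pr hpr0 hprL hprC m (fun i => X (Fin.natAdd (n + 1) i))
  obtain ⟨πA, πB, hπA, hπB, hT⟩ := exists_stdBlockPair hHD hI hU h₃ pr hpr0 hprL hprC n m X
  refine ⟨_, rfl, cY, cY', ?_⟩
  rw [hcY _ pA πA (fun k i => by rw [hA k i, hπA k i]), hcY' _ pB πB (fun k i => by rw [hB k i, hπB k i])]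
  exact hT _ rfl cY cY' hcY0 hcY'0

end ProdFin

end Model

end Summit.HodgeConjecture.CorCM

end
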